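import Literature.Topology.FourManifolds.LogBlend
import Literature.Topology.FourManifolds.NonSeparatingSpheresFibred
import HarnessLib

/-!
# Budney–Gabai Thm. 3.13: the equivariant fibration function of a straightened lift

Fact seat of `Literature.Topology.FourManifolds.BudneyGabai2019_thm_3_13`
(`NonSeparatingSpheres.lean`; R. Budney, D. Gabai, *Knotted 3-balls in `S⁴`*, arXiv:1912.09029,
Thm. 3.13).  In the classical argument for `n ≤ 2` the lift `K̃` of a non-separating sphere and
its deck translate `τ K̃` are simultaneously straightened, by a diffeomorphism `K` of the cyclic
cover `ℝ × Sⁿ`, to `{0} × Sⁿ` and `{b} × Sⁿ`; in these coordinates the deck transformation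
becomes a diffeomorphism `τ'` of `ℝ × Sⁿ` carrying the level `{t = 0}` to the level `{t = b}`
and the sublevel `{t < 0}` to `{t < b}`, but otherwise arbitrary.  To reglue one needs a
`C^∞` function `h` without critical points which is the height `t` above a collar of the seam
`{t = 0}` and satisfies `h ∘ τ' = h + b` across the seam (`NonSeparatingSpheresFibred.lean`
then turns the resulting equivariant fibration function into a diffeomorphism of `S¹ × Sⁿ`).
This file constructs `h` (`BudneyGabai2019_thm_3_13.exists_seamFunction`): below the seam the
transported height `F = pr₁ ∘ τ' - b` and above it the height `t` are blended by the
logarithmic partition of unity of `LogBlend.lean`, which keeps `∂ₜ h > 0` whatever the ratio of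
the normal derivatives of `F` and `t` along the seam; and then the equivariant fibration function
`f` of the original deck transformation `τ (t, y) = (t + 2π, y)` with zero set the lift.

* §1 (any manifold `Y`, `F : ℝ × Y → ℝ` smooth): the slice derivative
  `∂ₜF (t, y) = (F (·, y))' (t)` exists, equals `dF_{(t,y)} (1, 0)`, and is **jointly
  continuous** (read `F` in a chart of `Y`; `SliceDeriv.continuous`).
* §2 (`Y = Sⁿ`, `τ'` a diffeomorphism of `ℝ × Sⁿ` with `pr₁ (τ' q) < b ↔ pr₁ q < 0` and
  `pr₁ (τ' q) = b ↔ pr₁ q = 0`, `b > 0`): `F` vanishes exactly on the seam with the sign of `t`,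
  `∂ₜF > 0` on the seam (`dF ≠ 0` and `dF = 0` on the seam's tangent space), hence
  `m ≤ ∂ₜF ≤ M` on a slab `|t| ≤ δ₀` (tube lemma, compactness of `Sⁿ`); the blend
  `h = F + Λ(t/δ) (t - F)` of `LogBlend.exists_blend` is `C^∞`, equals `F` for `t ≤ δ₁` and `t`
  for `t ≥ δ`, has `∂ₜh > 0` on `|t| ≤ δ`, no critical points, zero set the seam, sign of `t`,
  `h < b` on the strip `0 ≤ t < b`, and `h (τ' q) = h q + b`, `pr₁ (τ' q) > 0` for `|pr₁ q| < ε`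
  (`BudneyGabai2019_thm_3_13.exists_seamFunction`).
* §3 (**the fibration function**, `exists_fibrationFunction_of_straightening`): given a
  diffeomorphism `K` of `ℝ × Sⁿ` straightening the lift `ẽ(Sⁿ)` to `{0} × Sⁿ` and compatible
  with the deck transformation `τ` at the seam (`pr₁ K (τ p) < b ↔ pr₁ K p < 0`,
  `pr₁ K (τ p) = b ↔ pr₁ K p = 0`, and every orbit `τᵏ p` eventually enters `{pr₁ K < 0}` and
  `{pr₁ K ≥ 0}`), tile `ℝ × Sⁿ` by the translates `τ'ᵏ [0, b) × Sⁿ` of the fundamental strip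
  (`τ' = K τ K⁻¹`; the tiling index `N q` is the greatest `k` with `pr₁ (τ'⁻ᵏ q) ≥ 0`), put
  `f̂ q = N q · b + h (τ'^{-N q} q)` — near every point one fixed formula `n₀ b + h ∘ τ'^{-n₀}`
  by the seam relation — and pull back: `f = (2π/b) f̂ ∘ K` is `C^∞`, without critical points,
  `f ∘ τ = f + 2π`, and `f = 0` exactly on `ẽ(Sⁿ)`.  This is the input of
  `NonSeparatingSpheresFibred.exists_diffeomorph_image_eq_of_fibration`.

Everything here is proved; no definition and no named fact is introduced.

## References

* R. Budney, D. Gabai, *Knotted 3-balls in `S⁴`*, arXiv:1912.09029 (v2), §3, Thm. 3.13.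
  [BudneyGabai2019]
* M. W. Hirsch, *Differential Topology*, GTM 33 (1976), Ch. 2 §2 (partitions of unity), Ch. 6
  §2 (regular level sets). [HirschDT1976]
-/

noncomputable section

open scoped Manifold ContDiff Topology Real
open Set Function Filter

namespace Literature.Topology.FourManifolds

/-! ### §1 The slice derivative of a smooth function on `ℝ × Y` -/

namespace SliceDeriv

variable {E H : Type*} [NormedAddCommGroup E] [NormedSpace ℝ E] [TopologicalSpace H]
  {J : ModelWithCorners ℝ E H} {Y : Type*} [TopologicalSpace Y] [ChartedSpace H Y]

/-- The slices `s ↦ F (s, y)` of a `C^∞` function on `ℝ × Y` are `C^∞`. [folklore] -/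
theorem contDiff_slice {F : ℝ × Y → ℝ} (hF : ContMDiff (𝓘(ℝ, ℝ).prod J) 𝓘(ℝ, ℝ) ∞ F) (y : Y) :
    ContDiff ℝ ∞ fun s : ℝ ↦ F (s, y) :=
  contMDiff_iff_contDiff.1 (hF.comp (contMDiff_id.prodMk contMDiff_const))

/-- The slice derivative exists: `HasDerivAt (F (·, y)) (∂ₜF (t, y)) t` with
`∂ₜF (t, y) := deriv (F (·, y)) t`. [folklore] -/
theorem hasDerivAt_slice {F : ℝ × Y → ℝ} (hF : ContMDiff (𝓘(ℝ, ℝ).prod J) 𝓘(ℝ, ℝ) ∞ F) (t : ℝ)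
    (y : Y) : HasDerivAt (fun s : ℝ ↦ F (s, y)) (deriv (fun s : ℝ ↦ F (s, y)) t) t :=
  (((contDiff_slice hF y).differentiable (by simp)) t).hasDerivAt

/-- **The slice derivative is the total derivative in the direction `(1, 0)`.** [folklore] -/
theorem mfderiv_apply_one_zero {F : ℝ × Y → ℝ} (hF : ContMDiff (𝓘(ℝ, ℝ).prod J) 𝓘(ℝ, ℝ) ∞ F)
    (t : ℝ) (y : Y) :
    mfderiv (𝓘(ℝ, ℝ).prod J) 𝓘(ℝ, ℝ) F (t, y) ((1 : ℝ), (0 : TangentSpace J y)) =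
      deriv (fun s : ℝ ↦ F (s, y)) t := by
  rw [mfderiv_prod_eq_add_apply (hF.mdifferentiableAt (by simp))]
  simp only [map_zero, add_zero]
  show mfderiv 𝓘(ℝ, ℝ) 𝓘(ℝ, ℝ) (fun s : ℝ ↦ F (s, y)) t 1 = _
  rw [mfderiv_eq_fderiv]
  rfl

/-- **The slice derivative of a smooth function is jointly continuous**: `(t, y) ↦ ∂ₜF (t, y)`
is continuous on `ℝ × Y` (in a chart `ψ` of `Y` at `y₀`, `∂ₜF (t, y)` is the partial derivative
of the smooth function `(t, x) ↦ F (t, ψ⁻¹ x)` on the open set `ℝ × ψ.target` of the vector space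
`ℝ × E`, evaluated at `(t, ψ y)`). [folklore] -/
theorem continuous [J.Boundaryless] [IsManifold J ∞ Y] {F : ℝ × Y → ℝ}
    (hF : ContMDiff (𝓘(ℝ, ℝ).prod J) 𝓘(ℝ, ℝ) ∞ F) :
    Continuous fun q : ℝ × Y ↦ deriv (fun s : ℝ ↦ F (s, q.2)) q.1 := by
  refine continuous_iff_continuousAt.2 fun q₀ ↦ ?_
  set ψ := extChartAt J q₀.2 with hψ
  set g : ℝ × E → ℝ := fun p ↦ F (p.1, ψ.symm p.2) with hg
  set U : Set (ℝ × E) := univ ×ˢ ψ.target with hU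
  have hUo : IsOpen U := isOpen_univ.prod (isOpen_extChartAt_target q₀.2)
  -- `g` is smooth on `U`
  have hgm : ContMDiffOn (𝓘(ℝ, ℝ).prod 𝓘(ℝ, E)) 𝓘(ℝ, ℝ) ∞ g U :=
    hF.comp_contMDiffOn (contMDiffOn_fst.prodMk
      ((contMDiffOn_extChartAt_symm q₀.2).comp contMDiffOn_snd fun p hp ↦ hp.2))
  have hgs : ContDiffOn ℝ ∞ g U := by
    rw [← modelWithCornersSelf_prod, chartedSpaceSelf_prod] at hgm
    exact contMDiffOn_iff_contDiffOn.1 hgm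
  have hcont : ContinuousOn (fderiv ℝ g) U := hgs.continuousOn_fderiv_of_isOpen hUo (by simp)
  -- on `U`, the slice derivative of `g` is `fderiv g · (1, 0)`
  have hslice : ∀ p ∈ U, deriv (fun s : ℝ ↦ g (s, p.2)) p.1 = fderiv ℝ g p ((1 : ℝ), (0 : E)) := by
    intro p hp
    have hga : HasFDerivAt g (fderiv ℝ g p) p :=
      ((hgs.differentiableOn (by simp)) p hp).differentiableAt (hUo.mem_nhds hp) |>.hasFDerivAt
    have h1 : HasDerivAt (fun s : ℝ ↦ ((s, p.2) : ℝ × E)) ((1 : ℝ), (0 : E)) p.1 :=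
      (hasDerivAt_id p.1).prodMk (hasDerivAt_const p.1 p.2)
    exact (hga.comp_hasDerivAt p.1 h1).deriv
  -- near `q₀`, `∂ₜF (t, y) = fderiv g (t, ψ y) (1, 0)`
  have hsrc : ∀ᶠ q in 𝓝 q₀, q.2 ∈ ψ.source := by
    have h : ψ.source ∈ 𝓝 q₀.2 := extChartAt_source_mem_nhds q₀.2
    exact continuous_snd.continuousAt.preimage_mem_nhds h
  have heq : (fun q : ℝ × Y ↦ deriv (fun s : ℝ ↦ F (s, q.2)) q.1) =ᶠ[𝓝 q₀]
      fun q ↦ fderiv ℝ g (q.1, ψ q.2) ((1 : ℝ), (0 : E)) := by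
    filter_upwards [hsrc] with q hq
    have h1 : (fun s : ℝ ↦ F (s, q.2)) = fun s ↦ g (s, ψ q.2) := by
      funext s
      simp only [hg, ψ.left_inv hq]
    rw [h1]
    exact hslice (q.1, ψ q.2) ⟨mem_univ _, ψ.map_source hq⟩
  refine (ContinuousAt.congr ?_ heq.symm)
  have h2 : ContinuousAt (fun q : ℝ × Y ↦ ((q.1, ψ q.2) : ℝ × E)) q₀ :=
    continuousAt_fst.prodMk ((continuousAt_extChartAt q₀.2).comp continuousAt_snd)
  have h3 : ContinuousAt (fderiv ℝ g) (q₀.1, ψ q₀.2) :=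
    hcont.continuousAt (hUo.mem_nhds ⟨mem_univ _, mem_extChartAt_target q₀.2⟩)
  exact (h3.comp_of_eq h2 rfl).clm_apply continuousAt_const

end SliceDeriv

/-! ### §2 The seam function -/

namespace BudneyGabai2019_thm_3_13

variable {n : ℕ}

/-- **The seam function of a straightened deck transformation.**  Let `τ'` be a diffeomorphism
of `ℝ × Sⁿ` and `b > 0` with `pr₁ (τ' q) < b ↔ pr₁ q < 0` and `pr₁ (τ' q) = b ↔ pr₁ q = 0` (so
`τ'` carries the seam `{t = 0}` onto `{t = b}` and the region below the one onto the region below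
the other).  Then there are `0 < ε`, `0 < δ < b` and a `C^∞` function `h : ℝ × Sⁿ → ℝ` without
critical points such that: `h = 0` exactly on the seam, `h > 0` exactly above it, `h < b` on the
strip `0 ≤ t < b`, `h (t, y) = t` for `t ≥ δ`, and — the point — **`h (τ' q) = h q + b` (and
`pr₁ (τ' q) > 0`) whenever `|pr₁ q| < ε`**.  Construction: `h = F + Λ(t/δ) (t - F)` with
`F = pr₁ ∘ τ' - b` and the logarithmic profile of `LogBlend.exists_blend`; see the module
docstring. [cite: BudneyGabai2019, Thm. 3.13] -/
theorem exists_seamFunction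
    (τ' : (ℝ × Metric.sphere (0 : EuclideanSpace ℝ (Fin (n + 1))) 1) ≃ₘ⟮𝓘(ℝ, ℝ).prod (𝓡 n),
      𝓘(ℝ, ℝ).prod (𝓡 n)⟯ (ℝ × Metric.sphere (0 : EuclideanSpace ℝ (Fin (n + 1))) 1))
    {b : ℝ} (hb : 0 < b) (hlt : ∀ q, (τ' q).1 < b ↔ q.1 < 0) (heq : ∀ q, (τ' q).1 = b ↔ q.1 = 0) :
    ∃ (h : ℝ × Metric.sphere (0 : EuclideanSpace ℝ (Fin (n + 1))) 1 → ℝ) (δ ε : ℝ),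
      0 < ε ∧ 0 < δ ∧ δ < b ∧
      ContMDiff (𝓘(ℝ, ℝ).prod (𝓡 n)) 𝓘(ℝ, ℝ) ∞ h ∧
      (∀ q, mfderiv (𝓘(ℝ, ℝ).prod (𝓡 n)) 𝓘(ℝ, ℝ) h q ≠ 0) ∧
      (∀ q, h q = 0 ↔ q.1 = 0) ∧ (∀ q, 0 < h q ↔ 0 < q.1) ∧
      (∀ q, 0 ≤ q.1 → q.1 < b → h q < b) ∧
      (∀ q, δ ≤ q.1 → h q = q.1) ∧
      (∀ q, |q.1| < ε → h (τ' q) = h q + b) ∧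
      (∀ q, |q.1| < ε → 0 < (τ' q).1) := by
  haveI : Nonempty (Metric.sphere (0 : EuclideanSpace ℝ (Fin (n + 1))) 1) :=
    (NormedSpace.sphere_nonempty.2 zero_le_one).to_subtype
  -- ### the transported height `F = pr₁ ∘ τ' - b`
  set F : ℝ × Metric.sphere (0 : EuclideanSpace ℝ (Fin (n + 1))) 1 → ℝ :=
    fun q ↦ (τ' q).1 - b with hFdef
  have hFs : ContMDiff (𝓘(ℝ, ℝ).prod (𝓡 n)) 𝓘(ℝ, ℝ) ∞ F :=
    ((contDiff_id.sub contDiff_const).contMDiff.comp contMDiff_fst).comp τ'.contMDiff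
  have hF0 : ∀ q, F q = 0 ↔ q.1 = 0 := fun q ↦ by rw [← heq q, hFdef]; exact sub_eq_zero
  have hFneg : ∀ q, F q < 0 ↔ q.1 < 0 := fun q ↦ by rw [← hlt q, hFdef]; exact sub_neg
  have hFpos : ∀ q, 0 < F q ↔ 0 < q.1 := fun q ↦ by
    constructor
    · intro h1
      rcases lt_trichotomy q.1 0 with h2 | h2 | h2
      · exact ((hFneg q).2 h2 |>.trans h1 |>.false).elim
      · rw [← hF0] at h2; rw [h2] at h1; exact (lt_irrefl _ h1).elim
      · exact h2
    · intro h1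
      rcases lt_trichotomy (F q) 0 with h2 | h2 | h2
      · exact (((hFneg q).1 h2).trans h1 |>.false).elim
      · rw [hF0] at h2; rw [h2] at h1; exact (lt_irrefl _ h1).elim
      · exact h2
  -- ### the slice derivative `F'`
  set F' : ℝ × Metric.sphere (0 : EuclideanSpace ℝ (Fin (n + 1))) 1 → ℝ :=
    fun q ↦ deriv (fun s : ℝ ↦ F (s, q.2)) q.1 with hF'def
  have hFd : ∀ t y, HasDerivAt (fun s : ℝ ↦ F (s, y)) (F' (t, y)) t := fun t y ↦
    SliceDeriv.hasDerivAt_slice hFs t y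
  have hF'c : Continuous F' := SliceDeriv.continuous hFs
  -- `dF ≠ 0`: `F ∘ τ'⁻¹ = pr₁ - b`
  have hFreg : ∀ q, mfderiv (𝓘(ℝ, ℝ).prod (𝓡 n)) 𝓘(ℝ, ℝ) F q ≠ 0 := by
    intro q hq
    set g : ℝ × Metric.sphere (0 : EuclideanSpace ℝ (Fin (n + 1))) 1 → ℝ :=
      fun r ↦ r.1 - b with hg
    have hgs : ContMDiff (𝓘(ℝ, ℝ).prod (𝓡 n)) 𝓘(ℝ, ℝ) ∞ g :=
      (contDiff_id.sub contDiff_const).contMDiff.comp contMDiff_fst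
    have hgF : g = F ∘ τ'.symm := by
      funext r
      simp [hg, hFdef]
    have h2 : mfderiv (𝓘(ℝ, ℝ).prod (𝓡 n)) 𝓘(ℝ, ℝ) g (τ' q) = 0 := by
      have hmdF : MDifferentiableAt (𝓘(ℝ, ℝ).prod (𝓡 n)) 𝓘(ℝ, ℝ) F (τ'.symm (τ' q)) := by
        rw [τ'.symm_apply_apply]; exact hFs.mdifferentiableAt (by simp)
      have hmdτ : MDifferentiableAt (𝓘(ℝ, ℝ).prod (𝓡 n)) (𝓘(ℝ, ℝ).prod (𝓡 n)) τ'.symm (τ' q) :=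
        τ'.symm.contMDiff.mdifferentiableAt (by simp)
      have hq' : mfderiv (𝓘(ℝ, ℝ).prod (𝓡 n)) 𝓘(ℝ, ℝ) F (τ'.symm (τ' q)) = 0 := by
        rw [τ'.symm_apply_apply]; exact hq
      rw [hgF, mfderiv_comp _ hmdF hmdτ, hq']
      exact ContinuousLinearMap.zero_comp _
    have h1 := SliceDeriv.mfderiv_apply_one_zero hgs (τ' q).1 (τ' q).2
    rw [Prod.mk.eta, h2] at h1
    simp only [hg] at h1
    rw [deriv_sub_const, deriv_id''] at h1
    have h1' : (0 : ℝ) = 1 := h1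
    exact zero_ne_one h1'
  -- `∂ₜF > 0` on the seam
  have hF'ne : ∀ y, F' (0, y) ≠ 0 := by
    intro y hzero
    apply hFreg (0, y)
    ext v
    rw [mfderiv_prod_eq_add_apply (hFs.mdifferentiableAt (by simp))]
    have h1 : mfderiv 𝓘(ℝ, ℝ) 𝓘(ℝ, ℝ) (fun s : ℝ ↦ F (s, y)) 0 = 0 := by
      have := (hFd 0 y).hasFDerivAt
      rw [hzero] at this
      rw [mfderiv_eq_fderiv, this.fderiv]
      ext
      simp
      rfl
    have h2 : (fun z : Metric.sphere (0 : EuclideanSpace ℝ (Fin (n + 1))) 1 ↦ F (0, z)) =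
        fun _ ↦ 0 := funext fun z ↦ (hF0 (0, z)).2 rfl
    rw [h1, h2, mfderiv_const]
    simp
    rfl
  have hF'0 : ∀ y, 0 < F' (0, y) := by
    intro y
    refine lt_of_le_of_ne ?_ (hF'ne y).symm
    have hlim := hasDerivAt_iff_tendsto_slope.1 (hFd 0 y)
    refine ge_of_tendsto hlim (eventually_nhdsWithin_of_forall fun t (ht : t ≠ 0) ↦ ?_)
    rw [slope_def_field, (hF0 (0, y)).2 rfl, sub_zero, sub_zero]
    rcases lt_or_gt_of_ne ht with ht | ht
    · exact div_nonneg_of_nonpos (le_of_lt ((hFneg (t, y)).2 ht)) ht.le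
    · exact div_nonneg (le_of_lt ((hFpos (t, y)).2 ht)) ht.le
  -- ### uniform bounds `m ≤ F' ≤ M` on a slab `|t| ≤ δ₀'` (compactness, tube lemma)
  obtain ⟨y₀, -, hy₀⟩ := isCompact_univ.exists_isMinOn univ_nonempty
    ((hF'c.comp (continuous_const.prodMk continuous_id)).continuousOn :
      ContinuousOn (fun y : Metric.sphere (0 : EuclideanSpace ℝ (Fin (n + 1))) 1 ↦ F' (0, y)) univ)
  set m₀ : ℝ := F' (0, y₀) with hm₀
  have hm₀pos : 0 < m₀ := hF'0 y₀
  have hm₀le : ∀ y, m₀ ≤ F' (0, y) := fun y ↦ hy₀ (mem_univ y)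
  obtain ⟨δ₀, hδ₀, hslab⟩ : ∃ δ₀ > 0, ∀ q : ℝ × Metric.sphere (0 : EuclideanSpace ℝ (Fin (n + 1))) 1,
      |q.1| ≤ δ₀ → m₀ / 2 < F' q := by
    have hO : IsOpen {q : ℝ × Metric.sphere (0 : EuclideanSpace ℝ (Fin (n + 1))) 1 | m₀ / 2 < F' q} :=
      isOpen_lt continuous_const hF'c
    obtain ⟨u, v, hu, -, h0u, hv, huv⟩ := generalized_tube_lemma isCompact_singleton isCompact_univ
      hO (fun q hq ↦ by
        obtain ⟨t, y⟩ := q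
        obtain ⟨h1, -⟩ := hq
        rw [mem_singleton_iff] at h1
        subst h1
        show m₀ / 2 < F' (0, y)
        linarith [hm₀le y])
    obtain ⟨ε₀, hε₀, hball⟩ := Metric.isOpen_iff.1 hu 0 (h0u (mem_singleton _))
    refine ⟨ε₀ / 2, by positivity, fun q hq ↦ ?_⟩
    have h1 : q.1 ∈ u := hball (by rw [Metric.mem_ball, Real.dist_0_eq_abs]; linarith)
    exact huv ⟨h1, hv (mem_univ q.2)⟩
  set δ₀' : ℝ := min δ₀ (b / 2) with hδ₀'
  have hδ₀'pos : 0 < δ₀' := lt_min hδ₀ (by positivity)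
  obtain ⟨Mb, hMb⟩ := (isCompact_Icc.prod isCompact_univ :
      IsCompact (Icc (-δ₀') δ₀' ×ˢ (univ : Set (Metric.sphere (0 : EuclideanSpace ℝ (Fin (n + 1))) 1)))).exists_bound_of_continuousOn
    hF'c.continuousOn
  set m : ℝ := m₀ / 2 with hm
  set M : ℝ := max Mb m with hM
  have hmpos : 0 < m := by positivity
  have hm' : ∀ (t : ℝ) (y : Metric.sphere (0 : EuclideanSpace ℝ (Fin (n + 1))) 1), |t| ≤ δ₀' →
      m ≤ F' (t, y) := fun t y ht ↦
    le_of_lt (hslab (t, y) (ht.trans (min_le_left _ _)))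
  have hM' : ∀ (t : ℝ) (y : Metric.sphere (0 : EuclideanSpace ℝ (Fin (n + 1))) 1), |t| ≤ δ₀' →
      F' (t, y) ≤ M := fun t y ht ↦ by
    have h1 := hMb (t, y) ⟨abs_le.1 ht, mem_univ _⟩
    rw [Real.norm_eq_abs] at h1
    exact (le_abs_self _).trans (h1.trans (le_max_left _ _))
  have hMpos : 0 < M := hmpos.trans_le (le_max_right _ _)
  -- `|F (t, y)| ≤ M |t|` on the slab (mean value theorem)
  have hFbound : ∀ q : ℝ × Metric.sphere (0 : EuclideanSpace ℝ (Fin (n + 1))) 1, |q.1| ≤ δ₀' →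
      |F q| ≤ M * |q.1| := by
    rintro ⟨t, y⟩ ht
    simp only at ht ⊢
    rcases lt_trichotomy t 0 with h0 | rfl | h0
    · obtain ⟨ξ, hξ, hξeq⟩ := exists_hasDerivAt_eq_slope (fun s : ℝ ↦ F (s, y)) (fun s ↦ F' (s, y))
        h0 (fun s _ ↦ (hFd s y).continuousAt.continuousWithinAt) (fun s _ ↦ hFd s y)
      have hξabs : |ξ| ≤ δ₀' := by
        rw [abs_of_neg (hξ.2)]; rw [abs_of_neg h0] at ht; linarith [hξ.1]
      rw [(hF0 (0, y)).2 rfl, zero_sub, zero_sub, neg_div_neg_eq, eq_div_iff h0.ne] at hξeq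
      have h1 : F (t, y) = F' (ξ, y) * t := by linarith
      rw [h1, abs_mul, abs_of_pos (hmpos.trans_le (hm' ξ y hξabs))]
      exact mul_le_mul_of_nonneg_right (hM' ξ y hξabs) (abs_nonneg _)
    · simp [(hF0 (0, y)).2 rfl]
    · obtain ⟨ξ, hξ, hξeq⟩ := exists_hasDerivAt_eq_slope (fun s : ℝ ↦ F (s, y)) (fun s ↦ F' (s, y))
        h0 (fun s _ ↦ (hFd s y).continuousAt.continuousWithinAt) (fun s _ ↦ hFd s y)
      have hξabs : |ξ| ≤ δ₀' := by
        rw [abs_of_pos hξ.1]; rw [abs_of_pos h0] at ht; linarith [hξ.2]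
      rw [(hF0 (0, y)).2 rfl, sub_zero, sub_zero, eq_div_iff h0.ne'] at hξeq
      have h1 : F (t, y) = F' (ξ, y) * t := by linarith
      rw [h1, abs_mul, abs_of_pos (hmpos.trans_le (hm' ξ y hξabs))]
      exact mul_le_mul_of_nonneg_right (hM' ξ y hξabs) (abs_nonneg _)
  -- ### the blend
  obtain ⟨Λ, δ, δ₁, hΛs, hδ₁, hδ₁δ, hδδ₀, hΛ0, hΛ1, hΛ01, hblend⟩ :=
    LogBlend.exists_blend (F := fun t y ↦ F (t, y)) (F' := fun t y ↦ F' (t, y)) hδ₀'pos hmpos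
      (fun y ↦ (hF0 (0, y)).2 rfl) (fun t y ht ↦ hFd t y) hm' hM'
  have hδpos : 0 < δ := hδ₁.trans hδ₁δ
  have hδb : δ < b := by
    have : δ₀' ≤ b / 2 := min_le_right _ _
    linarith
  set h : ℝ × Metric.sphere (0 : EuclideanSpace ℝ (Fin (n + 1))) 1 → ℝ :=
    fun q ↦ F q + Λ (q.1 / δ) * (q.1 - F q) with hhdef
  have hhs : ContMDiff (𝓘(ℝ, ℝ).prod (𝓡 n)) 𝓘(ℝ, ℝ) ∞ h := by
    have h1 : ContMDiff (𝓘(ℝ, ℝ).prod (𝓡 n)) 𝓘(ℝ, ℝ) ∞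
        fun q : ℝ × Metric.sphere (0 : EuclideanSpace ℝ (Fin (n + 1))) 1 ↦ Λ (q.1 / δ) :=
      (hΛs.comp (contDiff_id.div_const δ)).contMDiff.comp contMDiff_fst
    have h2 : ContMDiff (𝓘(ℝ, ℝ).prod (𝓡 n)) 𝓘(ℝ, ℝ) ∞
        fun q : ℝ × Metric.sphere (0 : EuclideanSpace ℝ (Fin (n + 1))) 1 ↦ q.1 - F q :=
      contMDiff_fst.sub hFs
    exact hFs.add (h1.smul h2)
  -- values below `δ₁` and above `δ`
  have hhF : ∀ q, q.1 ≤ δ₁ → h q = F q := fun q hq ↦ by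
    simp only [hhdef, hΛ0 (q.1 / δ) (div_le_div_of_nonneg_right hq hδpos.le), zero_mul, add_zero]
  have hht : ∀ q, δ ≤ q.1 → h q = q.1 := fun q hq ↦ by
    simp only [hhdef, hΛ1 (q.1 / δ) ((one_le_div hδpos).2 hq), one_mul, add_sub_cancel]
  -- ### the slice derivative of `h` is positive on `(-δ₀', ∞)`
  have hhd : ∀ (t : ℝ) (y : Metric.sphere (0 : EuclideanSpace ℝ (Fin (n + 1))) 1), -δ₀' < t →
      0 < deriv (fun s : ℝ ↦ h (s, y)) t := by
    intro t y ht
    by_cases h1 : t < δ₁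
    · -- `h = F` near `t`
      have hev : (fun s : ℝ ↦ h (s, y)) =ᶠ[𝓝 t] fun s ↦ F (s, y) := by
        filter_upwards [Iio_mem_nhds h1] with s hs
        exact hhF (s, y) hs.le
      rw [hev.deriv_eq, (hFd t y).deriv]
      have habs : |t| ≤ δ₀' := by
        rw [abs_le]; constructor <;> linarith [hδ₁δ, hδδ₀]
      exact hmpos.trans_le (hm' t y habs)
    · by_cases h2 : t ≤ δ
      · obtain ⟨d, hd, hdd⟩ := hblend y t (hδ₁.trans_le (not_lt.1 h1)) h2
        rw [hdd.deriv]
        exact (by positivity : 0 < min m 1 / 2).trans_le hd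
      · -- `h = t` near `t`
        have hev : (fun s : ℝ ↦ h (s, y)) =ᶠ[𝓝 t] fun s ↦ s := by
          filter_upwards [Ioi_mem_nhds (not_le.1 h2)] with s hs
          exact hht (s, y) hs.le
        rw [hev.deriv_eq, deriv_id'']
        exact one_pos
  -- ### no critical points
  have hhreg : ∀ q, mfderiv (𝓘(ℝ, ℝ).prod (𝓡 n)) 𝓘(ℝ, ℝ) h q ≠ 0 := by
    intro q
    by_cases h1 : q.1 < δ₁
    · have hev : h =ᶠ[𝓝 q] F := by
        have : Iio δ₁ ×ˢ (univ : Set (Metric.sphere (0 : EuclideanSpace ℝ (Fin (n + 1))) 1)) ∈ 𝓝 q :=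
          (isOpen_Iio.prod isOpen_univ).mem_nhds ⟨h1, mem_univ _⟩
        filter_upwards [this] with r hr
        exact hhF r (le_of_lt hr.1)
      rw [hev.mfderiv_eq]
      exact hFreg q
    · intro hzero
      have hpos := hhd q.1 q.2 (by linarith [not_lt.1 h1])
      have := SliceDeriv.mfderiv_apply_one_zero hhs q.1 q.2
      rw [Prod.mk.eta] at this
      rw [hzero] at this
      have h0 : (0 : ℝ) = deriv (fun s : ℝ ↦ h (s, q.2)) q.1 := this
      rw [← h0] at hpos
      exact lt_irrefl _ hpos
  -- ### zero set, sign, and the bound `h < b` on the strip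
  have hh0y : ∀ y, h (0, y) = 0 := fun y ↦ by rw [hhF (0, y) hδ₁.le]; exact (hF0 (0, y)).2 rfl
  have hmono : ∀ y : Metric.sphere (0 : EuclideanSpace ℝ (Fin (n + 1))) 1,
      StrictMonoOn (fun s : ℝ ↦ h (s, y)) (Ici (0 : ℝ)) := fun y ↦
    strictMonoOn_of_deriv_pos (convex_Ici 0)
      ((hhs.comp (contMDiff_id.prodMk contMDiff_const)).continuous.continuousOn)
      fun s hs ↦ hhd s y (by rw [interior_Ici] at hs; linarith [hs.out])
  have hzero : ∀ q, h q = 0 ↔ q.1 = 0 := by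
    rintro ⟨t, y⟩
    simp only
    constructor
    · intro h1
      by_contra h2
      rcases lt_or_gt_of_ne h2 with h3 | h3
      · have := (hFneg (t, y)).2 h3
        rw [← hhF (t, y) (by simp only; linarith)] at this
        linarith
      · have := hmono y (mem_Ici.2 le_rfl) (mem_Ici.2 h3.le) h3
        simp only [hh0y] at this
        linarith
    · rintro rfl
      exact hh0y y
  have hposiff : ∀ q, 0 < h q ↔ 0 < q.1 := by
    rintro ⟨t, y⟩
    simp only
    constructor
    · intro h1
      by_contra h2
      push Not at h2
      rcases h2.lt_or_eq with h3 | h3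
      · have := (hFneg (t, y)).2 h3
        rw [← hhF (t, y) (by simp only; linarith)] at this
        linarith
      · rw [h3, hh0y] at h1
        exact lt_irrefl _ h1
    · intro h1
      have := hmono y (mem_Ici.2 le_rfl) (mem_Ici.2 h1.le) h1
      simpa only [hh0y] using this
  have hltb : ∀ q, 0 ≤ q.1 → q.1 < b → h q < b := by
    rintro ⟨t, y⟩ h0 h1
    simp only at h0 h1 ⊢
    by_cases h2 : δ ≤ t
    · rw [hht (t, y) h2]; exact h1
    · have h3 : h (t, y) < h (δ, y) := hmono y (mem_Ici.2 h0) (mem_Ici.2 hδpos.le) (not_le.1 h2)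
      rw [hht (δ, y) le_rfl] at h3
      exact h3.trans hδb
  -- ### the seam relation
  set ε : ℝ := min δ₁ ((b - δ) / (2 * (M + 1))) with hε
  have hεpos : 0 < ε := lt_min hδ₁ (by
    apply div_pos (by linarith) (by positivity))
  have hεδ₁ : ε ≤ δ₁ := min_le_left _ _
  have hseam1 : ∀ q : ℝ × Metric.sphere (0 : EuclideanSpace ℝ (Fin (n + 1))) 1, |q.1| < ε →
      δ < (τ' q).1 := by
    intro q hq
    have h1 : |q.1| ≤ δ₀' := by linarith [hδ₁δ, hδδ₀]
    have h2 := hFbound q h1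
    have h3 : M * |q.1| ≤ M * ε := mul_le_mul_of_nonneg_left hq.le hMpos.le
    have h4 : M * ε ≤ (b - δ) / 2 := by
      calc M * ε ≤ M * ((b - δ) / (2 * (M + 1))) :=
            mul_le_mul_of_nonneg_left (min_le_right _ _) hMpos.le
        _ = (b - δ) / 2 * (M / (M + 1)) := by field_simp
        _ ≤ (b - δ) / 2 * 1 := by
            apply mul_le_mul_of_nonneg_left _ (by linarith)
            rw [div_le_one (by positivity)]; linarith
        _ = (b - δ) / 2 := mul_one _
    have h5 : (τ' q).1 = F q + b := by simp [hFdef]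
    rw [h5]
    have := neg_abs_le (F q)
    linarith
  refine ⟨h, δ, ε, hεpos, hδpos, hδb, hhs, hhreg, hzero, hposiff, hltb, hht, fun q hq ↦ ?_,
    fun q hq ↦ hδpos.trans (hseam1 q hq)⟩
  rw [hht (τ' q) (le_of_lt (hseam1 q hq)), hhF q (by linarith [le_abs_self q.1])]
  simp [hFdef]

/-! ### §3 The fibration function of a straightened lift -/

/-- If `g` has nonzero differential at `Φ x` for a diffeomorphism `Φ`, then so has `g ∘ Φ` at
`x` (the differential of `Φ` is onto). [folklore] -/
theorem mfderiv_comp_diffeomorph_ne_zero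
    {Φ : (ℝ × Metric.sphere (0 : EuclideanSpace ℝ (Fin (n + 1))) 1) ≃ₘ⟮𝓘(ℝ, ℝ).prod (𝓡 n),
      𝓘(ℝ, ℝ).prod (𝓡 n)⟯ (ℝ × Metric.sphere (0 : EuclideanSpace ℝ (Fin (n + 1))) 1)}
    {g : ℝ × Metric.sphere (0 : EuclideanSpace ℝ (Fin (n + 1))) 1 → ℝ}
    (hg : ContMDiff (𝓘(ℝ, ℝ).prod (𝓡 n)) 𝓘(ℝ, ℝ) ∞ g)
    {x : ℝ × Metric.sphere (0 : EuclideanSpace ℝ (Fin (n + 1))) 1}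
    (hx : mfderiv (𝓘(ℝ, ℝ).prod (𝓡 n)) 𝓘(ℝ, ℝ) g (Φ x) ≠ 0) :
    mfderiv (𝓘(ℝ, ℝ).prod (𝓡 n)) 𝓘(ℝ, ℝ) (g ∘ Φ) x ≠ 0 := by
  intro h0
  apply hx
  have hsurj : Surjective (mfderiv (𝓘(ℝ, ℝ).prod (𝓡 n)) (𝓘(ℝ, ℝ).prod (𝓡 n)) Φ x) := by
    exact (Φ.mfderivToContinuousLinearEquiv (WithTop.coe_ne_zero.mpr ENat.top_ne_zero)
      x).surjective
  rw [mfderiv_comp x (hg.mdifferentiableAt (by simp)) (Φ.contMDiff.mdifferentiableAt (by simp))]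
    at h0
  ext w
  obtain ⟨v, rfl⟩ := hsurj w
  exact congrArg (fun T ↦ T v) h0

/-- **The equivariant fibration function of a straightened lift** (Budney–Gabai Thm. 3.13,
classical cases: the "Moreover" — every non-separating sphere is a fibre of a fibre bundle over
`S¹` — from a straightening of the lift and of its deck translate).  Let `ẽ : Sⁿ → ℝ × Sⁿ` be a
map and `K` a diffeomorphism of `ℝ × Sⁿ` with: `pr₁ (K p) = 0 ↔ p ∈ ẽ(Sⁿ)` (`K` straightens
the lift to the level `0`); `pr₁ (K (τ p)) < b ↔ pr₁ (K p) < 0` and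
`pr₁ (K (τ p)) = b ↔ pr₁ (K p) = 0` for the deck transformation `τ (t, y) = (t + 2π, y)` and some
`b > 0` (`K` straightens the translate to the level `b`, sides to sides); and every orbit
`k ↦ τᵏ p` meets both `{pr₁ K < 0}` and `{pr₁ K ≥ 0}`.  Then there is a `C^∞` function
`f : ℝ × Sⁿ → ℝ` without critical points with `f ∘ τ = f + 2π` and `f = 0` exactly on `ẽ(Sⁿ)`.
Proof: in the coordinates `K` the deck transformation is `τ' = K τ K⁻¹`; take the seam function
`h` of `exists_seamFunction`; the sets `Aₖ = τ'ᵏ {t ≥ 0}` decrease, and every point lies in a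
unique `A_N ∖ A_{N+1} = τ'^N ([0, b) × Sⁿ)`; put `f̂ = N b + h ∘ τ'^{-N}` — near each point this
is one smooth formula `n₀ b + h ∘ τ'^{-n₀}` thanks to `h ∘ τ' = h + b` across the seam — and
`f = (2π/b) f̂ ∘ K`. [cite: BudneyGabai2019, Thm. 3.13] -/
theorem exists_fibrationFunction_of_straightening
    {el : Metric.sphere (0 : EuclideanSpace ℝ (Fin (n + 1))) 1 →
      ℝ × Metric.sphere (0 : EuclideanSpace ℝ (Fin (n + 1))) 1}
    (K : (ℝ × Metric.sphere (0 : EuclideanSpace ℝ (Fin (n + 1))) 1) ≃ₘ⟮𝓘(ℝ, ℝ).prod (𝓡 n),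
      𝓘(ℝ, ℝ).prod (𝓡 n)⟯ (ℝ × Metric.sphere (0 : EuclideanSpace ℝ (Fin (n + 1))) 1))
    {b : ℝ} (hb : 0 < b)
    (hK1 : ∀ p, (K p).1 = 0 ↔ p ∈ range el)
    (hK2 : ∀ p, (K (p.1 + 2 * π, p.2)).1 < b ↔ (K p).1 < 0)
    (hK2' : ∀ p, (K (p.1 + 2 * π, p.2)).1 = b ↔ (K p).1 = 0)
    (hK4 : ∀ p : ℝ × Metric.sphere (0 : EuclideanSpace ℝ (Fin (n + 1))) 1,
      (∃ k : ℤ, (K (p.1 + k * (2 * π), p.2)).1 < 0) ∧ ∃ k : ℤ, 0 ≤ (K (p.1 + k * (2 * π), p.2)).1) :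
    ∃ f : ℝ × Metric.sphere (0 : EuclideanSpace ℝ (Fin (n + 1))) 1 → ℝ,
      ContMDiff (𝓘(ℝ, ℝ).prod (𝓡 n)) 𝓘(ℝ, ℝ) ∞ f ∧
      (∀ p, f (p.1 + 2 * π, p.2) = f p + 2 * π) ∧ (∀ p, f p = 0 ↔ p ∈ range el) ∧
      ∀ p, mfderiv (𝓘(ℝ, ℝ).prod (𝓡 n)) 𝓘(ℝ, ℝ) f p ≠ 0 := by
  have hπ : (0 : ℝ) < 2 * π := by positivity
  -- ### translations as diffeomorphisms, and the powers `σ k = τ'^{-k} = K τ^{-k} K⁻¹`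
  have trans : ∀ a : ℝ, ∃ T : (ℝ × Metric.sphere (0 : EuclideanSpace ℝ (Fin (n + 1))) 1) ≃ₘ⟮
      𝓘(ℝ, ℝ).prod (𝓡 n), 𝓘(ℝ, ℝ).prod (𝓡 n)⟯
      (ℝ × Metric.sphere (0 : EuclideanSpace ℝ (Fin (n + 1))) 1), ∀ p, T p = (p.1 + a, p.2) := by
    intro a
    refine ⟨⟨⟨fun p ↦ (p.1 + a, p.2), fun p ↦ (p.1 + -a, p.2), fun p ↦ by simp, fun p ↦ by simp⟩,
      Cylinder.contMDiff_translate a, Cylinder.contMDiff_translate (-a)⟩, fun p ↦ rfl⟩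
  choose T hT using trans
  set σ : ℤ → (ℝ × Metric.sphere (0 : EuclideanSpace ℝ (Fin (n + 1))) 1) ≃ₘ⟮
      𝓘(ℝ, ℝ).prod (𝓡 n), 𝓘(ℝ, ℝ).prod (𝓡 n)⟯
      (ℝ × Metric.sphere (0 : EuclideanSpace ℝ (Fin (n + 1))) 1) :=
    fun k ↦ K.symm.trans ((T (-(k * (2 * π)))).trans K) with hσ
  have hσapply : ∀ (k : ℤ) q, σ k q = K ((K.symm q).1 + -(k * (2 * π)), (K.symm q).2) := by
    intro k q
    simp only [hσ, Diffeomorph.coe_trans, comp_apply, hT]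
  set τ' := σ (-1) with hτ'
  have hτ'apply : ∀ q, τ' q = K ((K.symm q).1 + 2 * π, (K.symm q).2) := fun q ↦ by
    rw [hτ', hσapply]; push_cast; ring_nf
  have hσ0 : ∀ q, σ 0 q = q := fun q ↦ by rw [hσapply]; simp
  have hσadd : ∀ (j k : ℤ) q, σ (j + k) q = σ j (σ k q) := by
    intro j k q
    rw [hσapply, hσapply, hσapply, K.symm_apply_apply]
    push_cast
    ring_nf
  have hτ'σ : ∀ (k : ℤ) q, τ' (σ k q) = σ (k - 1) q := fun k q ↦ by
    rw [hτ', ← hσadd]; ring_nf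
  have hστ' : ∀ (k : ℤ) q, σ k (τ' q) = σ (k - 1) q := fun k q ↦ by
    rw [hτ', ← hσadd]; ring_nf
  -- the level property of `τ'` and of `τ'⁻¹ = σ 1`
  have hlt : ∀ q, (τ' q).1 < b ↔ q.1 < 0 := fun q ↦ by
    rw [hτ'apply, hK2 (K.symm q), K.apply_symm_apply]
  have heq : ∀ q, (τ' q).1 = b ↔ q.1 = 0 := fun q ↦ by
    rw [hτ'apply, hK2' (K.symm q), K.apply_symm_apply]
  have hlt1 : ∀ r, (σ 1 r).1 < 0 ↔ r.1 < b := fun r ↦ by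
    have := hlt (σ 1 r)
    rw [hτ'σ, sub_self, hσ0] at this
    exact this.symm
  -- ### the seam function
  obtain ⟨h, δ, ε, hε, hδ, hδb, hhs, hhreg, hh0, hhpos, hhltb, hht, hseam, hseampos⟩ :=
    exists_seamFunction τ' hb hlt heq
  -- ### the tiling index
  set P : (ℝ × Metric.sphere (0 : EuclideanSpace ℝ (Fin (n + 1))) 1) → ℤ → Prop :=
    fun q k ↦ 0 ≤ (σ k q).1 with hP
  have hσsucc : ∀ (k : ℤ) q, σ (k + 1) q = σ 1 (σ k q) := fun k q ↦ by
    rw [hσapply, hσapply, hσapply, K.symm_apply_apply]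
    push_cast
    ring_nf
  have hanti : ∀ q k, P q (k + 1) → P q k := by
    intro q k hk
    simp only [hP] at hk ⊢
    rw [hσsucc] at hk
    by_contra hneg
    push Not at hneg
    have : (σ k q).1 < b := hneg.trans hb
    rw [← hlt1] at this
    linarith
  have hchain : ∀ q (k : ℤ) (d : ℕ), P q (k + d) → P q k := by
    intro q k d
    induction d with
    | zero => simp
    | succ d ih =>
      intro hk
      apply ih
      apply hanti
      have : k + ((d + 1 : ℕ) : ℤ) = k + d + 1 := by push_cast; ring
      rwa [this] at hk
  have hchain' : ∀ q (j k : ℤ), j ≤ k → P q k → P q j := by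
    intro q j k hjk hk
    obtain ⟨d, rfl⟩ := Int.le.dest hjk
    exact hchain q j d hk
  have hσneg : ∀ (k : ℤ) q, σ (-k) q = K ((K.symm q).1 + k * (2 * π), (K.symm q).2) := by
    intro k q
    rw [hσapply]
    push_cast
    ring_nf
  have hgreatest : ∀ q, ∃ N : ℤ, P q N ∧ ∀ k, P q k → k ≤ N := by
    intro q
    obtain ⟨⟨k₁, hk₁⟩, ⟨k₂, hk₂⟩⟩ := hK4 (K.symm q)
    refine Int.exists_greatest_of_bdd ⟨-k₁, fun k hk ↦ ?_⟩ ⟨-k₂, ?_⟩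
    · by_contra hlt'
      push Not at hlt'
      have h1 : P q (-k₁) := hchain' q (-k₁) k hlt'.le hk
      simp only [hP, hσneg] at h1
      linarith
    · simp only [hP, hσneg]
      exact hk₂
  choose N hN hNmax using hgreatest
  -- characterisation of the index: `P q k` and `¬ P q (k + 1)` force `N q = k`
  have hNeq : ∀ q k, P q k → ¬ P q (k + 1) → N q = k := by
    intro q k hk hk1
    apply le_antisymm
    · by_contra hlt'
      push Not at hlt'
      exact hk1 (hchain' q (k + 1) (N q) (by omega) (hN q))
    · exact hNmax q k hk
  -- the strip of `q`: `r = σ (N q) q` has `0 ≤ r.1 < b`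
  have hstrip : ∀ q, 0 ≤ (σ (N q) q).1 ∧ (σ (N q) q).1 < b := by
    intro q
    refine ⟨hN q, ?_⟩
    have h1 : ¬ P q (N q + 1) := fun h1 ↦ by have := hNmax q _ h1; omega
    simp only [hP, not_le] at h1
    rw [hσsucc] at h1
    exact (hlt1 _).1 h1
  -- ### the function `f̂` upstairs and its local formula
  set fh : ℝ × Metric.sphere (0 : EuclideanSpace ℝ (Fin (n + 1))) 1 → ℝ :=
    fun q ↦ N q * b + h (σ (N q) q) with hfh
  have hlocal : ∀ (n₀ : ℤ) q, (σ n₀ q).1 ∈ Ioo (-ε) b → fh q = n₀ * b + h (σ n₀ q) := by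
    intro n₀ q hq
    by_cases h0 : 0 ≤ (σ n₀ q).1
    · -- `N q = n₀`
      have h1 : N q = n₀ := hNeq q n₀ h0 (by
        simp only [hP, not_le]
        rw [hσsucc]
        exact (hlt1 _).2 hq.2)
      simp only [hfh, h1]
    · -- `N q = n₀ - 1` and the seam relation
      push Not at h0
      have habs : |(σ n₀ q).1| < ε := by rw [abs_lt]; exact ⟨hq.1, h0.trans hε⟩
      have h1 : N q = n₀ - 1 := hNeq q (n₀ - 1) (by
          simp only [hP]
          rw [← hτ'σ]
          exact (hseampos _ habs).le)
        (by simp only [sub_add_cancel, hP, not_le]; exact h0)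
      simp only [hfh, h1]
      rw [← hτ'σ, hseam _ habs]
      push_cast
      ring
  have hnhds : ∀ q₀, ∀ᶠ q in 𝓝 q₀, (σ (N q₀) q).1 ∈ Ioo (-ε) b := fun q₀ ↦
    (continuous_fst.comp (σ (N q₀)).continuous).continuousAt.preimage_mem_nhds
      (isOpen_Ioo.mem_nhds (show (σ (N q₀) q₀).1 ∈ Ioo (-ε) b from
        ⟨by linarith [(hstrip q₀).1], (hstrip q₀).2⟩))
  have hfhs : ContMDiff (𝓘(ℝ, ℝ).prod (𝓡 n)) 𝓘(ℝ, ℝ) ∞ fh := by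
    intro q₀
    have hev : fh =ᶠ[𝓝 q₀] fun q ↦ (N q₀ : ℝ) * b + h (σ (N q₀) q) := by
      filter_upwards [hnhds q₀] with q hq
      exact hlocal (N q₀) q hq
    refine ContMDiffAt.congr_of_eventuallyEq ?_ hev
    exact (contMDiffAt_const.add ((hhs.comp (σ (N q₀)).contMDiff).contMDiffAt))
  have hfhreg : ∀ q, mfderiv (𝓘(ℝ, ℝ).prod (𝓡 n)) 𝓘(ℝ, ℝ) fh q ≠ 0 := by
    intro q₀
    have hev : fh =ᶠ[𝓝 q₀] fun q ↦ (N q₀ : ℝ) * b + (h ∘ σ (N q₀)) q := by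
      filter_upwards [hnhds q₀] with q hq
      exact hlocal (N q₀) q hq
    rw [hev.mfderiv_eq]
    have hmd : MDifferentiableAt (𝓘(ℝ, ℝ).prod (𝓡 n)) 𝓘(ℝ, ℝ) (h ∘ σ (N q₀)) q₀ :=
      (hhs.comp (σ (N q₀)).contMDiff).mdifferentiableAt (by simp)
    have h1 : mfderiv (𝓘(ℝ, ℝ).prod (𝓡 n)) 𝓘(ℝ, ℝ) (fun q ↦ (N q₀ : ℝ) * b + (h ∘ σ (N q₀)) q) q₀ =
        mfderiv (𝓘(ℝ, ℝ).prod (𝓡 n)) 𝓘(ℝ, ℝ) (h ∘ σ (N q₀)) q₀ := by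
      have h2 := ((hasMFDerivAt_const (I := 𝓘(ℝ, ℝ).prod (𝓡 n)) (I' := 𝓘(ℝ, ℝ))
        ((N q₀ : ℝ) * b) q₀).add hmd.hasMFDerivAt).mfderiv
      exact h2.trans (zero_add _)
    rw [h1]
    exact mfderiv_comp_diffeomorph_ne_zero hhs (hhreg _)
  -- ### equivariance upstairs: `f̂ ∘ τ' = f̂ + b`
  have hNτ' : ∀ q, N (τ' q) = N q + 1 := by
    intro q
    apply hNeq
    · simp only [hP, hστ', add_sub_cancel_right]
      exact hN q
    · simp only [hP, hστ', not_le]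
      have h1 : σ (N q + 1 + 1 - 1) q = σ 1 (σ (N q) q) := by
        rw [hσapply, hσapply, hσapply, K.symm_apply_apply]
        push_cast
        ring_nf
      rw [h1]
      exact (hlt1 _).2 (hstrip q).2
  have hfhτ' : ∀ q, fh (τ' q) = fh q + b := by
    intro q
    simp only [hfh, hNτ', hστ', add_sub_cancel_right]
    push_cast
    ring
  -- ### zero set upstairs
  have hfh0 : ∀ q, fh q = 0 ↔ q.1 = 0 := by
    intro q
    obtain ⟨hs0, hsb⟩ := hstrip q
    have hh0le : 0 ≤ h (σ (N q) q) := by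
      rcases hs0.lt_or_eq with h1 | h1
      · exact ((hhpos _).2 h1).le
      · exact ((hh0 _).2 h1.symm).ge
    have hhlt : h (σ (N q) q) < b := hhltb _ hs0 hsb
    constructor
    · intro hq
      simp only [hfh] at hq
      -- `N q = 0`
      have hN0 : N q = 0 := by
        rcases lt_trichotomy (N q) 0 with h1 | h1 | h1
        · exfalso
          have h2 : (N q : ℝ) ≤ -1 := by exact_mod_cast (show N q ≤ -1 by omega)
          nlinarith
        · exact h1
        · exfalso
          have h2 : (1 : ℝ) ≤ N q := by exact_mod_cast (show 1 ≤ N q by omega)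
          nlinarith
      rw [hN0] at hq hs0
      simp only [Int.cast_zero, zero_mul, zero_add] at hq
      rw [hh0, hσ0] at hq
      exact hq
    · intro hq
      have hN0 : N q = 0 := hNeq q 0 (by simp only [hP, hσ0]; exact hq.ge)
        (by simp only [zero_add, hP, not_le]; rw [hlt1]; rw [hq]; exact hb)
      simp only [hfh, hN0, Int.cast_zero, zero_mul, zero_add, hσ0]
      exact (hh0 q).2 hq
  -- ### pull back along `K` and rescale
  have hfs : ContMDiff (𝓘(ℝ, ℝ).prod (𝓡 n)) 𝓘(ℝ, ℝ) ∞
      fun p : ℝ × Metric.sphere (0 : EuclideanSpace ℝ (Fin (n + 1))) 1 ↦ (2 * π / b) * fh (K p) := by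
    have h1 : ContMDiff 𝓘(ℝ, ℝ) 𝓘(ℝ, ℝ) ∞ (fun x : ℝ ↦ (2 * π / b) * x) :=
      (contDiff_const.mul contDiff_id).contMDiff
    exact h1.comp (hfhs.comp K.contMDiff)
  refine ⟨fun p ↦ (2 * π / b) * fh (K p), hfs, fun p ↦ ?_, fun p ↦ ?_, fun p ↦ ?_⟩
  · -- equivariance
    show (2 * π / b) * fh (K (p.1 + 2 * π, p.2)) = (2 * π / b) * fh (K p) + 2 * π
    have h1 : K (p.1 + 2 * π, p.2) = τ' (K p) := by rw [hτ'apply, K.symm_apply_apply]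
    rw [h1, hfhτ']
    field_simp
  · show (2 * π / b) * fh (K p) = 0 ↔ p ∈ range el
    rw [mul_eq_zero, hfh0, hK1]
    simp [hπ.ne', hb.ne']
  · have hmd : MDifferentiableAt (𝓘(ℝ, ℝ).prod (𝓡 n)) 𝓘(ℝ, ℝ) (fh ∘ K) p :=
      (hfhs.comp K.contMDiff).mdifferentiableAt (by simp)
    have h1 := (hmd.hasMFDerivAt.const_smul (2 * π / b)).mfderiv
    have h2 : (fun p : ℝ × Metric.sphere (0 : EuclideanSpace ℝ (Fin (n + 1))) 1 ↦
        (2 * π / b) * fh (K p)) = (2 * π / b) • (fh ∘ K) := rfl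
    rw [h2, h1]
    intro h0
    apply mfderiv_comp_diffeomorph_ne_zero hfhs (hfhreg (K p)) (Φ := K)
    ext v
    have h3 : (2 * π / b) * @id ℝ (mfderiv (𝓘(ℝ, ℝ).prod (𝓡 n)) 𝓘(ℝ, ℝ) (fh ∘ K) p v) = 0 :=
      congrArg (fun T ↦ T v) h0
    have h4 : (2 * π / b) ≠ 0 := by positivity
    exact (mul_eq_zero.1 h3).resolve_left h4

end BudneyGabai2019_thm_3_13


end Literature.Topology.FourManifolds

end
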